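import Literature.MathematicalPhysics.QuantumFieldTheory.Balaban1983to89.B1Eq323ConnectedGraphBound
import HarnessLib

/-!
# `Balaban1983to89.B1Eq324BenfattoAppendixDClustering` — [BenfattoEtAl1978] Appendix D pp. 165–166, point ii) and the damping
# sentence: THE EXPONENTIAL CLUSTERING OF CONNECTED DIAGRAMS WITH A SOURCE AND DECAYING PROPAGATORS — the combinatorial
# half of the second term of (5.29), in the tree's `LegDiagram` vocabulary, PROVED

statement-level skeleton of published theorems with citation tags; proofs where landed; nothing here is a claim about the
Yang–Mills mass gap

WHY THIS MODULE (cell `pub-ymgap`, seat `dag-n08-b`, node N08 «first missing estimate» lane; sequel of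
`B1Eq324BenfattoSect5JointCumulants` / `…Sect5ChiToOne`).  After the χ's are replaced by 1 ((5.29) first term), the joint
truncated expectations `𝓔^T_0(Ψ̃′₁, Ψ̃″₁, Ψ̃₂; h₁, h₂, k₂)` of POLYNOMIALS of the (conditioned) free field are bounded in Appendix D
by: i) multilinearity down to monomials `z_{Δ_{i₁}}⋯z_{Δ_{iᵣ}}` with the Hamiltonian's weights `e^{−(ϰ/2)d(Δ…)}` (tree:
`…Sect5ChiToOne.ursellOf_moment_sum_eq_sum_of_moments`); ii) *"𝓔^T_0(z^{A₁}, z^{A₂}, z^{A₃}; 1, 1, 1) is by definition an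
algebraic sum of products of expectations values. As it is well known, once these expectations are expressed via the Wick
theorem as sum of products of 2-point functions, the only terms that survive are the so called "connected diagrams" where at
least one z_Δ in each set z^{A₁}, z^{A₂}, z^{A₃} is connected to another z_Δ belonging to a different set"*; and then *"If we
recall now that at least one z_Δ in each term of Ψ̃″₁ belong to □′∖Γ₄(□) the exponential factors arising from i) and ii) give
rise to an overall dumping factor that is at least exp −(ϰ/4)b^{3/2} where b^{3/2}/2 is the length of the smallest path
connecting a set of points constructed in such a way that one point belongs by sure to □′/Γ₄(□) and at least another one
belongs to Γ₂"* (p. 166, verbatim from the page image `bcg_p166_s3.png`).  The tree already holds the abstract form of ii):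
p13's `LatticeModels.LegDiagram.ursellOf_dmoment` — the Ursell function of DIAGRAM MOMENTS `Σ_g Π_{B∈g} w(B)` (set partitions
`g` of the legs into blocks; blocks of size 1 = legs contracted to a SOURCE, size 2 = propagators) is the sum over the
CONNECTED diagrams — and r14's `B1Eq323ConnectedGraphBound` turned it into a VOLUME bound for [Balaban1982Higgs1]'s clusters.
Here the same engine yields the DECAY bound Appendix D needs: with source weights `|w{l}| ≤ K₀` (the conditioned mean `u`,
(C.7)–(C.8)), propagators `|w{a,b}| ≤ K₀e^{−δρ(a,b)}` ((C.2)/(C.6)) and no higher blocks (Wick), the connected sum is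
`≤ #diagrams·K₀^{#legs}·exp(−(δ/2)(ρ(u,w) − intra-cluster lengths))` for ANY two legs `u, w` — the «smallest path» bound, by
r14's `connects_of_isConn` + r19's `le_sum_of_connects`.  The MEASURE half (the joint moments of monomials of
`condField d α β Γ z̄` ARE such diagram moments: Wick's theorem with a source for the shifted `gaussianFieldOfKernel`) and
the instantiation on print's corridors are NOT in this file.

DICTIONARY.  Legs `Λ` (one per factor `z_Δ` of the monomials, `own l` = its monomial/cluster `∈ J`, all clusters present:
r14's `allV J`, no observable); `ρ : Λ → Λ → ℝ` a pseudo-distance on the legs (print: the lattice distance of the tesserae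
`Δ_l`); block weights `w : Finset Λ → ℝ` (singletons ↦ mean, pairs ↦ covariance, larger ↦ 0); `dval`, `dmoment`, `diags`,
`IsConn` as in `LatticeModels.UrsellConnectedDiagrams`; «intra-cluster lengths» ↦ `Σ_{(a,b): own a = own b} ρ(a,b)` (print
absorbs them in the Hamiltonian's `e^{−(ϰ/2)d(Δ₁…Δ_p)}`, point i)).

WHAT IS PROVED (theorems only; no definition, no named fact, no `sorry`; axioms standard).
* §1 `sum_blockPairs_le`, **`dist_le_of_isConn`** — generic-ρ twins of r14's `sum_blockPairs_le` / `tdist_le_of_isConn`: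
  on a connected diagram `ρ(u,w) ≤ Σ_{same cluster}ρ + Σ_{B}Σ_{a,b∈B}ρ(a,b)`.
* §2 **`abs_dval_le`** — `|dval g| ≤ K₀^{|Λ|}·exp(−(δ/2)Σ_{B∈g}Σ_{a,b∈B}ρ(a,b))` (sources `≤ K₀`, propagators
  `≤ K₀e^{−δρ}`, no higher blocks, `K₀ ≥ 1`).
* §3 **`abs_sum_conn_dval_le`** (the connected sum: `≤ #diags·K₀^{|Λ|}·e^{−(δ/2)(ρ(u,w₀) − intra)}`) and ★
  **`abs_ursellOf_dmoment_le_exp`**: `|(dmoment)ᵀ(allV J)| ≤ 2^{|Λ|}·2^{2^{|Λ|}}·K₀^{|Λ|}·exp(−(δ/2)(ρ(u,w₀) − Σ_{same cluster}ρ))`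
  for any legs `u, w₀` (`ursellOf_dmoment` + r14's `card_diags_le`).

HONEST SCOPE / NOT HERE.  Pure finite combinatorics + real inequalities: no measure, no Gaussian.  NOT here: (a) Wick's theorem
with a source identifying the moments of the conditioned free field's monomials with `dmoment` (the tree has the centred case
for `gaussianFieldOfKernel`, `HiggsFluctMeasureWickPairingSum.integral_finsetProd_eval_eq_wickSum`, and the finite-dimensional
sourced case `BIJ88TruncationConnected306.gmoment_eq_dmoment`; the shifted-kernel-field instance is the next item); (b) the
instantiation `K₀, δ, ρ` from (C.2)/(C.6)/(C.8) and the corridor geometry `ρ(u,w₀) ≥ b^{3/2}/2`, `intra ≤` the Hamiltonian's tree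
lengths (boxes line); (c) print's constant `exp −(ϰ/4)b^{3/2}` (here `δ/2` on `ρ − intra`; the split of `ϰ` between i) and ii)
is bookkeeping).  `BasicLemmaPrinted` stays OPEN.  NOT summit progress; count-neutral for N08; nothing of [Balaban1985UV3] is
asserted.
-/

open Finset
open scoped BigOperators

namespace Literature.MathematicalPhysics.QuantumFieldTheory.Balaban1983to89.B1Eq324BenfattoAppendixDClustering

open Literature.Probability.LatticeModels (IsSetPartition setPartitions mem_setPartitions ursellOf)
open Literature.Probability.LatticeModels.LegDiagram (legs mem_legs diags mem_diags IsDiag Sep IsConn dval dmoment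
  ursellOf_dmoment)
open Literature.MathematicalPhysics.QuantumFieldTheory.Balaban1983to89.B3Ineq213 (Connects)
open Literature.MathematicalPhysics.QuantumFieldTheory.Balaban1983to89.B1Ineq358TreeLength (le_sum_of_connects)
open Literature.MathematicalPhysics.QuantumFieldTheory.Balaban1983to89.B1Eq323ConnectedGraphBound
  (allV some_mem_allV none_not_mem_allV edgeSet mem_edgeSet connects_of_isConn isSetPartition_of_mem_diags
   fst_eq_empty_of_mem_diags card_le_of_isSetPartition card_diags_le)

variable {J : Type} [Fintype J] [DecidableEq J] {Λ : Type} [Fintype Λ] [DecidableEq Λ] (own : Λ → J)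
variable (ρ : Λ → Λ → ℝ)

/-! ## §1  Geometry of a connected diagram for an arbitrary pseudo-distance on the legs -/

section Geometry

/-- The pairs joined by a common block have total ρ-length at most the total block length `Σ_B Σ_{a,b∈B} ρ(a,b)` (generic-ρ
twin of `B1Eq323ConnectedGraphBound.sum_blockPairs_le`). [cite: BenfattoEtAl1978, Appendix D p.166] -/
theorem sum_blockPairs_le (hnn : ∀ a b, 0 ≤ ρ a b) {π : Finset (Finset Λ)} (hπ : IsSetPartition (univ : Finset Λ) π) :
    ∑ p ∈ univ.filter (fun p : Λ × Λ => ∃ B ∈ π, p.1 ∈ B ∧ p.2 ∈ B), ρ p.1 p.2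
      ≤ ∑ B ∈ π, ∑ a ∈ B, ∑ b ∈ B, ρ a b := by
  have hsub : univ.filter (fun p : Λ × Λ => ∃ B ∈ π, p.1 ∈ B ∧ p.2 ∈ B) ⊆ π.biUnion fun B => B ×ˢ B := by
    intro p hp
    obtain ⟨B, hB, h1, h2⟩ := (mem_filter.1 hp).2
    exact mem_biUnion.2 ⟨B, hB, mem_product.2 ⟨h1, h2⟩⟩
  have hdisj : (π : Set (Finset Λ)).PairwiseDisjoint fun B => B ×ˢ B := by
    intro B hB B' hB' hne
    exact disjoint_product.2 (Or.inl (hπ.disjoint (mem_coe.1 hB) (mem_coe.1 hB') hne))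
  calc ∑ p ∈ univ.filter (fun p : Λ × Λ => ∃ B ∈ π, p.1 ∈ B ∧ p.2 ∈ B), ρ p.1 p.2
      ≤ ∑ p ∈ π.biUnion (fun B => B ×ˢ B), ρ p.1 p.2 :=
        sum_le_sum_of_subset_of_nonneg hsub fun p _ _ => hnn p.1 p.2
    _ = ∑ B ∈ π, ∑ a ∈ B, ∑ b ∈ B, ρ a b := by
        rw [sum_biUnion hdisj]
        exact sum_congr rfl fun B _ => sum_product _ _ _

/-- **EVERY PAIRWISE DISTANCE OF A CONNECTED DIAGRAM IS CONTROLLED BY THE INTRA-CLUSTER PAIRS AND THE BLOCKS** (generic-ρ twin of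
`B1Eq323ConnectedGraphBound.tdist_le_of_isConn`): for a pseudo-distance `ρ` (zero diagonal, symmetric, triangle inequality,
non-negative) and a connected diagram `g` on all the clusters, `ρ(u,w) ≤ Σ_{(a,b) same cluster} ρ(a,b) + Σ_{B∈g} Σ_{a,b∈B} ρ(a,b)`
— «the length of the smallest path connecting a set of points» of Appendix D. [cite: BenfattoEtAl1978, Appendix D p.166] -/
theorem dist_le_of_isConn (h0 : ∀ a, ρ a a = 0) (hsymm : ∀ a b, ρ a b = ρ b a) (htri : ∀ a b c, ρ a c ≤ ρ a b + ρ b c)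
    (hnn : ∀ a b, 0 ≤ ρ a b) {g : Finset Λ × Finset (Finset Λ)} (hg : g ∈ diags own (allV J))
    (hc : IsConn own (allV J) g) (u w : Λ) :
    ρ u w ≤ (∑ p ∈ univ.filter (fun p : Λ × Λ => own p.1 = own p.2), ρ p.1 p.2)
        + ∑ B ∈ g.2, ∑ a ∈ B, ∑ b ∈ B, ρ a b := by
  have h1 := le_sum_of_connects ρ h0 hsymm htri hnn (connects_of_isConn own hg hc) u w
  set S₁ := univ.filter (fun p : Λ × Λ => own p.1 = own p.2) with hS₁
  set S₂ := univ.filter (fun p : Λ × Λ => ∃ B ∈ g.2, p.1 ∈ B ∧ p.2 ∈ B) with hS₂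
  set f : Λ × Λ → ℝ := fun p => ρ p.1 p.2 with hf
  have hu : ∑ e ∈ S₁ ∪ S₂, f e ≤ ∑ e ∈ S₁, f e + ∑ e ∈ S₂, f e := by
    rw [← sum_union_inter]
    exact le_add_of_nonneg_right (sum_nonneg fun p _ => hnn p.1 p.2)
  have hS : edgeSet own g = S₁ ∪ S₂ := by
    rw [edgeSet, filter_or]
  rw [hS] at h1
  exact h1.trans (hu.trans (add_le_add le_rfl (sum_blockPairs_le ρ hnn (isSetPartition_of_mem_diags own hg))))

end Geometry

/-! ## §2  The value of one diagram: sources, decaying propagators, no higher blocks -/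

section Value

variable (w : Finset Λ → ℝ) (ω : Finset Λ → ℝ) {K₀ δ : ℝ}

omit [Fintype J] [DecidableEq J] [Fintype Λ] in
/-- The length `Σ_{a,b∈B} ρ(a,b)` of a singleton block vanishes and of a pair is `2ρ(a,b)`. [folklore] -/
private theorem blockLen_le_two (h0 : ∀ a, ρ a a = 0) (hsymm : ∀ a b, ρ a b = ρ b a) {B : Finset Λ} (hB : B.Nonempty)
    (hB2 : B.card ≤ 2) :
    (B.card = 1 ∧ ∑ a ∈ B, ∑ b ∈ B, ρ a b = 0) ∨
      ∃ a b, a ≠ b ∧ B = {a, b} ∧ ∑ a ∈ B, ∑ b ∈ B, ρ a b = 2 * ρ a b := by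
  rcases Nat.lt_or_ge B.card 2 with h | h
  · left
    have h1 : B.card = 1 := by have := hB.card_pos; omega
    obtain ⟨a, rfl⟩ := card_eq_one.1 h1
    exact ⟨h1, by simp [h0]⟩
  · right
    have h2 : B.card = 2 := le_antisymm hB2 h
    obtain ⟨a, b, hab, rfl⟩ := card_eq_two.1 h2
    refine ⟨a, b, hab, rfl, ?_⟩
    rw [sum_pair hab, sum_pair hab, sum_pair hab, h0, h0, hsymm b a]
    ring

/-- **THE VALUE OF ONE DIAGRAM ON ALL THE CLUSTERS** (no observable): with SOURCE weights `|w{l}| ≤ K₀` (the conditioned mean),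
PROPAGATOR weights `|w{a,b}| ≤ K₀e^{−δρ(a,b)}` («2-point functions» with exponential decay), `w B = 0` for `|B| ≥ 3` (Wick), and
`K₀ ≥ 1`: `|dval g| ≤ K₀^{|Λ|}·exp(−(δ/2)·Σ_{B∈g} Σ_{a,b∈B} ρ(a,b))`. [cite: BenfattoEtAl1978, Appendix D p.166] -/
theorem abs_dval_le (h0 : ∀ a, ρ a a = 0) (hsymm : ∀ a b, ρ a b = ρ b a) (hK₀ : 1 ≤ K₀)
    (hw1 : ∀ l, |w {l}| ≤ K₀) (hw2 : ∀ a b, a ≠ b → |w {a, b}| ≤ K₀ * Real.exp (-(δ * ρ a b)))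
    (hw3 : ∀ B : Finset Λ, 3 ≤ B.card → w B = 0)
    {g : Finset Λ × Finset (Finset Λ)} (hg : g ∈ diags own (allV J)) :
    |dval w ω (allV J) g| ≤
      K₀ ^ Fintype.card Λ * Real.exp (-(δ / 2 * ∑ B ∈ g.2, ∑ a ∈ B, ∑ b ∈ B, ρ a b)) := by
  have hπ := isSetPartition_of_mem_diags own hg
  have hval : dval w ω (allV J) g = ∏ B ∈ g.2, w B := by
    rw [dval, if_neg none_not_mem_allV, mul_one]
  rw [hval]
  by_cases hbig : ∃ B ∈ g.2, 3 ≤ B.card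
  · obtain ⟨B, hB, hB3⟩ := hbig
    rw [prod_eq_zero hB (hw3 B hB3), abs_zero]
    positivity
  have hsmall : ∀ B ∈ g.2, B.card ≤ 2 := fun B hB => by
    by_contra h
    exact hbig ⟨B, hB, by omega⟩
  -- block by block
  have hblock : ∀ B ∈ g.2, |w B| ≤ K₀ * Real.exp (-(δ / 2 * ∑ a ∈ B, ∑ b ∈ B, ρ a b)) := by
    intro B hB
    rcases blockLen_le_two ρ h0 hsymm (hπ.nonempty_of_mem hB) (hsmall B hB) with ⟨h1, hlen⟩ | ⟨a, b, hab, rfl, hlen⟩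
    · obtain ⟨l, rfl⟩ := card_eq_one.1 h1
      rw [hlen, mul_zero, neg_zero, Real.exp_zero, mul_one]
      exact hw1 l
    · rw [hlen]
      have : -(δ / 2 * (2 * ρ a b)) = -(δ * ρ a b) := by ring
      rw [this]
      exact hw2 a b hab
  rw [Finset.abs_prod]
  calc ∏ B ∈ g.2, |w B| ≤ ∏ B ∈ g.2, K₀ * Real.exp (-(δ / 2 * ∑ a ∈ B, ∑ b ∈ B, ρ a b)) :=
        prod_le_prod (fun B _ => abs_nonneg _) hblock
    _ = K₀ ^ g.2.card * Real.exp (-(δ / 2 * ∑ B ∈ g.2, ∑ a ∈ B, ∑ b ∈ B, ρ a b)) := by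
        rw [prod_mul_distrib, prod_const, ← Real.exp_sum]
        congr 2
        rw [mul_sum, ← sum_neg_distrib]
    _ ≤ K₀ ^ Fintype.card Λ * Real.exp (-(δ / 2 * ∑ B ∈ g.2, ∑ a ∈ B, ∑ b ∈ B, ρ a b)) := by
        refine mul_le_mul_of_nonneg_right (pow_le_pow_right₀ hK₀ ?_) (Real.exp_pos _).le
        exact (card_le_of_isSetPartition hπ).trans (card_univ (α := Λ)).le

end Value

/-! ## §3  The connected-diagram sum: exponential clustering -/

section Clustering

variable (w : Finset Λ → ℝ) (ω : Finset Λ → ℝ) {K₀ δ : ℝ}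

/-- **EXPONENTIAL CLUSTERING OF THE CONNECTED-DIAGRAM SUM** («the exponential factors arising from i) and ii) give rise to an overall
dumping factor … where … is the length of the smallest path connecting a set of points constructed in such a way that one point
belongs by sure to □′∖Γ₄(□) and at least another one belongs to Γ₂»): under the hypotheses of `abs_dval_le` and for a genuine
pseudo-distance `ρ`, for ANY two legs `u, w₀`,
`|Σ_{g connected} dval g| ≤ #diags · K₀^{|Λ|} · exp(−(δ/2)(ρ(u,w₀) − Σ_{(a,b) same cluster} ρ(a,b)))`.
[cite: BenfattoEtAl1978, Appendix D p.166] -/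
theorem abs_sum_conn_dval_le (h0 : ∀ a, ρ a a = 0) (hsymm : ∀ a b, ρ a b = ρ b a)
    (htri : ∀ a b c, ρ a c ≤ ρ a b + ρ b c) (hnn : ∀ a b, 0 ≤ ρ a b) (hK₀ : 1 ≤ K₀) (hδ : 0 ≤ δ)
    (hw1 : ∀ l, |w {l}| ≤ K₀) (hw2 : ∀ a b, a ≠ b → |w {a, b}| ≤ K₀ * Real.exp (-(δ * ρ a b)))
    (hw3 : ∀ B : Finset Λ, 3 ≤ B.card → w B = 0) (u w₀ : Λ) :
    |∑ g ∈ (diags own (allV J)).filter (IsConn own (allV J)), dval w ω (allV J) g| ≤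
      ((diags own (allV J)).card : ℝ) * (K₀ ^ Fintype.card Λ *
        Real.exp (-(δ / 2 * (ρ u w₀ - ∑ p ∈ univ.filter (fun p : Λ × Λ => own p.1 = own p.2), ρ p.1 p.2)))) := by
  set intra := ∑ p ∈ univ.filter (fun p : Λ × Λ => own p.1 = own p.2), ρ p.1 p.2 with hintra
  have hterm : ∀ g ∈ (diags own (allV J)).filter (IsConn own (allV J)),
      |dval w ω (allV J) g| ≤ K₀ ^ Fintype.card Λ * Real.exp (-(δ / 2 * (ρ u w₀ - intra))) := by
    intro g hg
    obtain ⟨hgd, hgc⟩ := mem_filter.1 hg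
    refine (abs_dval_le own ρ w ω h0 hsymm hK₀ hw1 hw2 hw3 hgd).trans ?_
    refine mul_le_mul_of_nonneg_left (Real.exp_le_exp.2 ?_) (pow_nonneg (zero_le_one.trans hK₀) _)
    have hd := dist_le_of_isConn own ρ h0 hsymm htri hnn hgd hgc u w₀
    have : ρ u w₀ - intra ≤ ∑ B ∈ g.2, ∑ a ∈ B, ∑ b ∈ B, ρ a b := by linarith
    nlinarith
  refine (abs_sum_le_sum_abs _ _).trans ((sum_le_sum hterm).trans ?_)
  rw [sum_const, nsmul_eq_mul]
  exact mul_le_mul_of_nonneg_right (by exact_mod_cast card_filter_le _ _)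
    (mul_nonneg (pow_nonneg (zero_le_one.trans hK₀) _) (Real.exp_pos _).le)

/-- **APPENDIX D, point ii) + the damping, generic form**: the TRUNCATED function of the diagram moments of all the clusters
(= the sum over the CONNECTED diagrams, `LatticeModels.LegDiagram.ursellOf_dmoment` — «the only terms that survive are the so
called "connected diagrams"») is exponentially small in the distance between any two legs, up to the intra-cluster lengths:
`|(dmoment)ᵀ(all clusters)| ≤ 2^{|Λ|}·2^{2^{|Λ|}}·K₀^{|Λ|}·exp(−(δ/2)(ρ(u,w₀) − Σ_{(a,b) same cluster} ρ(a,b)))`.  The MEASURE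
half (that the joint moments of the monomials `z_{Δ_{i₁}}⋯z_{Δ_{iᵣ}}` of the conditioned free field ARE such diagram moments,
with `w{l}` the conditioned mean and `w{a,b}` the conditioned covariance — Wick's theorem with a source) is not in this file.
[cite: BenfattoEtAl1978, Appendix D p.166] -/
theorem abs_ursellOf_dmoment_le_exp [Nonempty J] (h0 : ∀ a, ρ a a = 0) (hsymm : ∀ a b, ρ a b = ρ b a)
    (htri : ∀ a b c, ρ a c ≤ ρ a b + ρ b c) (hnn : ∀ a b, 0 ≤ ρ a b) (hK₀ : 1 ≤ K₀) (hδ : 0 ≤ δ)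
    (hw1 : ∀ l, |w {l}| ≤ K₀) (hw2 : ∀ a b, a ≠ b → |w {a, b}| ≤ K₀ * Real.exp (-(δ * ρ a b)))
    (hw3 : ∀ B : Finset Λ, 3 ≤ B.card → w B = 0) (u w₀ : Λ) :
    |ursellOf (dmoment own w ω) (allV J)| ≤
      2 ^ Fintype.card Λ * 2 ^ 2 ^ Fintype.card Λ * (K₀ ^ Fintype.card Λ *
        Real.exp (-(δ / 2 * (ρ u w₀ - ∑ p ∈ univ.filter (fun p : Λ × Λ => own p.1 = own p.2), ρ p.1 p.2)))) := by
  have hV : (allV J).Nonempty := by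
    obtain ⟨j⟩ := ‹Nonempty J›
    exact ⟨some j, some_mem_allV j⟩
  rw [ursellOf_dmoment (own := own) w ω hV]
  refine (abs_sum_conn_dval_le own ρ w ω h0 hsymm htri hnn hK₀ hδ hw1 hw2 hw3 u w₀).trans ?_
  exact mul_le_mul_of_nonneg_right (card_diags_le own)
    (mul_nonneg (pow_nonneg (zero_le_one.trans hK₀) _) (Real.exp_pos _).le)

end Clustering

end Literature.MathematicalPhysics.QuantumFieldTheory.Balaban1983to89.B1Eq324BenfattoAppendixDClustering
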